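import Summits.BirchSwinnertonDyer.Rank1Residual.X5.TwoAdicTargetsMultEisensteinLower
import Summits.BirchSwinnertonDyer.Rank1Residual.X5.TwoAdicTargetsMultConverse
import Summits.BirchSwinnertonDyer.Rank1Residual.X2.AnalyticInvariants
import HarnessLib

/-!
# Class O1 (X5, `p = 2`, non-CM): the Eisenstein direction at a MULTIPLICATIVE `2`, part 3 — at
# analytic rank `0`, ON THE KATO–NÉRON ROAD, the lower half `MissingLowerBoundAt W 2` IS the `2`-adic
# main conjecture at the datum (PROVED, both signs); and T-mult-4 (`⊗ℚ`) + analytic `μ = 0` ⇒ T-mult-4-int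

HONEST FRAMING (cell `bsd-2adic`, run/shared/lean/pub/bsd-2adic/, FULL-BSD rank ≤ 1 programme
tranche 1b, D-0036; seat `bsd-2adic-mult-3`, D-0074 (A) row «find: 19923 `MultLowerHalfAtTwo`»):
research routes; no claim beyond the stated classes; nothing here is booked; no mark of RESIDUAL-MAP
§I moves. Theorems only: 0 typed targets, 0 named facts. BSD is NOT proved by any of this. Continues
`X5/TwoAdicTargetsMultEisenstein{,Lower}.lean`.

THE POINT (strength statements about item 19923 for the planner / tribunal T1). (a) On the cell's
`μ = 0` road the Kato side is an INTEGRAL Néron-normalised datum (`L₀ ∈ char_Λ X`, `ι L₀ = ϖ·L₂(f,−1)`;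
split: `ι(T·L₁) = ϖ·L₂(f,1)`, `L₁ ∈ char_Λ X`). GIVEN that datum at analytic rank `0`, the per-pair
statement of 19923 `MissingLowerBoundAt W 2` is EQUIVALENT to the main conjecture at the datum
(`char_Λ X = (L₀)` resp. `(L₁)`): the lower half is the REVERSE inequality of G11a-mult / G11a-split
(`mainConjectureAtTwo{Nonsplit,Split}_of_divisibilityRat_of_le`) in Miller's currency — no cheaper
lower half exists on that road. (b) The `⊗ℚ` Eisenstein target T-mult-4 + the two analytic
certificates of the road give the integral target T-mult-4-int (§4).

* `valuation_le_of_missingLowerBoundAt` (PROVED) — Miller's currency inverted: at analytic rank `0`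
  (`L(E,1) ≠ 0`, GZK), `MissingLowerBoundAt W 2` gives, for the rational `t = L(E,1)/Ω_E`,
  `ord₂ t ≤ ord₂ #Ш + ord₂ ∏c_ℓ − 2 ord₂ #E(ℚ)_tors` (`#Ш_an = t · #E(ℚ)² / ∏c_ℓ`, the `q` is unique).
* `mainConjectureAtTwoNonsplit_of_missingLowerBoundAt` (PROVED) — non-split `2`, rank `0`: the display
  A235 at `2` (`hEC`), GZK, the Kato–Néron integral datum at the newform's `ϖ`, and
  `MissingLowerBoundAt W 2` ⇒ `char_Λ X = (L₀)`.
* `mainConjectureAtTwoSplit_of_missingLowerBoundAt` (PROVED) — split `2`, rank `0`: A236 at `2`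
  (`hEC`), a Tate datum, the forward `κ₁`-inequality (Greenberg–Stevens at `2`,
  `kappaOne_of_greenbergStevens`), GZK, the split Kato–Néron datum and `MissingLowerBoundAt W 2` ⇒
  `char_Λ X = (L₁)` (up to the conceded `T`: `ι(T·L₁) = ϖ·L`).
* `missingLowerBoundAt_iff_mainConjecture_nonsplit_two`, `…_split_two` (PROVED) — the packaged
  equivalences at a fixed datum.
* **`multEisensteinDivisibilityAtTwo_of_multLowerRat_of_analyticMu` (PROVED, §4 — the ANALYTIC `μ = 0`
  upgrade)** — the cell's valuation-blind Eisenstein target T-mult-4 `MultLowerDivisibilityAtTwoRat W`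
  (`2ⁿ·ι f_X = ι h·L`, the research object of the rank-`0` `2`-CONVERSE road of item 19219) + the
  Néron-integrality certificate `ϖ·L ∈ ι(Λ)` + the analytic `μ`-certificate `X2.AnalyticMuLE W 2 0`
  (`μ(ϖ·L₂) = 0`, ONE coefficient of norm `> 1/2`; kit-certified per curve, EVIDENCE) ⇒ T-mult-4-int.
  Pure `Λ`-algebra (`mem_span_of_C_int_mul_C_pow_mul_eq`: `μ(L₀) = 0` cancels `2ⁿ` and the numerator
  of `ϖ` — the Eisenstein twin of the Greenberg–Vatsal upgrade `MuZeroUpgrade.…`). CONSEQUENCE: on every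
  class carrying the two certificates (all door-ready classes do), the lower half (19923) and the
  `2`-converse (19219) hinge on ONE AND THE SAME `⊗ℚ` research object, T-mult-4.

References: [GreenbergLNM1716] §4 pp. 112–113; [MazurTateTeitelbaum1986Invent] §I.10, §I.14, §II.1;
[SkinnerUrban2014] proof of Thm. 3.6.4 (p. 43; two inclusions ⇔ equality; shape);
[GreenbergVatsal2000] p. 4 (μ = 0 upgrade; shape); [Miller2011LMS] Def. 1.1.
-/

set_option autoImplicit false

noncomputable section

open scoped Classical MatrixGroups ModularForm

open CongruenceSubgroup WeierstrassCurve Literature.NumberTheory.EllipticCurves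
  Literature.NumberTheory.EllipticCurves.ModularForms
  Literature.NumberTheory.EllipticCurves.Greenberg1999
  Literature.NumberTheory.EllipticCurves.Wuthrich2014
  Literature.NumberTheory.EllipticCurves.Rank1Residual
  Literature.NumberTheory.EllipticCurves.Rank1Residual.Typed
  Literature.NumberTheory.Transcendental
  Summit.BirchSwinnertonDyer.Rank1Residual.X1.MuLambda
  Summit.BirchSwinnertonDyer.Rank1Residual.X1.MuPart

namespace Summit.BirchSwinnertonDyer.Rank1Residual.X5.O1

variable (W : WeierstrassCurve ℚ) [W.IsElliptic] [W.IsGloballyMinimal]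

/-! ## §1 Miller's currency inverted: the lower half as an inequality on `t = L(E,1)/Ω_E` -/

/-- **The lower half read on `t = L(E,1)/Ω_E` (PROVED).** At analytic rank `0` (`L(E,1) ≠ 0`), GZK
gives `#Ш_an = t · #E(ℚ)² / ∏c_ℓ` for the rational `t` with `L(E,1)/Ω_E = t`
(`shaAn_eq_of_L_one_div_eq`); the rational value of `#Ш_an` is unique, so `MissingLowerBoundAt W 2`
(`∃ q, #Ш_an = q ∧ ord₂ q ≤ ord₂ #Ш`) says `ord₂ t + 2 ord₂ #E(ℚ)_tors − ord₂ ∏c_ℓ ≤ ord₂ #Ш`.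
[cite: Miller2011LMS, Def. 1.1 and §1] -/
theorem valuation_le_of_missingLowerBoundAt (hGZK : rank_eq_analyticRank_of_analyticRank_le_one)
    (hL : W.entireLFunction 1 ≠ 0) (hlow : MissingLowerBoundAt W 2) {t : ℚ}
    (ht : W.entireLFunction 1 / (W.realPeriodRat : ℂ) = (t : ℂ)) :
    padicValRat 2 t ≤ (padicValNat 2 W.shaOrder : ℤ) + padicValNat 2 W.tamagawaProduct -
      2 * padicValNat 2 W.torsionOrder := by
  obtain ⟨-, hE, -, hshaAn⟩ := shaAn_eq_of_L_one_div_eq hGZK W hL ht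
  haveI := hE
  obtain ⟨q, hq, hle⟩ := hlow
  have hqq : q = t * (Nat.card W.toAffine.Point : ℚ) ^ 2 / (W.tamagawaProduct : ℚ) := by
    exact_mod_cast hq.symm.trans hshaAn
  have hΩ : (W.realPeriodRat : ℂ) ≠ 0 := by exact_mod_cast W.realPeriodRat_pos_holds.ne'
  have ht0 : t ≠ 0 := by
    rintro rfl
    apply hL
    rw [Rat.cast_zero, div_eq_zero_iff] at ht
    exact ht.resolve_right hΩ
  have hcard : (Nat.card W.toAffine.Point : ℚ) ≠ 0 := by
    exact_mod_cast (Nat.card_pos (α := W.toAffine.Point)).ne'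
  have htam : (W.tamagawaProduct : ℚ) ≠ 0 := by
    exact_mod_cast (W.tamagawaProduct_pos_holds : 0 < W.tamagawaProduct).ne'
  have hcardT : (Nat.card W.toAffine.Point : ℚ) = (W.torsionOrder : ℚ) := by
    exact_mod_cast (W.torsionOrder_eq_natCard_of_finite).symm
  rw [hqq, padicValRat.div (mul_ne_zero ht0 (pow_ne_zero 2 hcard)) htam,
    padicValRat.mul ht0 (pow_ne_zero 2 hcard), padicValRat.pow, hcardT] at hle
  simp only [padicValRat.of_nat, Nat.cast_ofNat] at hle
  linarith

/-! ## §2 Non-split `2`: the lower half + the Kato–Néron datum ⇒ the main conjecture at the datum -/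

/-- **Non-split multiplicative `2`, analytic rank `0`: `MissingLowerBoundAt W 2` + the integral
Kato–Néron datum ⇒ `char_Λ X = (L₀)` (PROVED).** Inputs: Greenberg's non-split display at `2` (`hEC`),
GZK, `L(E,1) ≠ 0`, a cyclotomic datum, a newform `f` with its `2`-adic `L`-function (`α = −1`), the
period ratio `ϖ` (`ϖ · Ω_E = Ω⁺_f`), the datum "`X` torsion and `ι L₀ = ϖ · L` for some `L₀ ∈ char_Λ X`"
(`hdiv`; = K11a upgraded by `μ = 0` and the Néron-integrality certificate, `X5/TwoAdicTargetsMultEndAlpha.lean`)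
and the lower half (`hlow`). Mechanism: `hlow` is the REVERSE inequality of G11a-mult
(`valuation_le_of_missingLowerBoundAt`), which forces the cofactor of `L₀` to be a unit
(`mainConjectureAtTwoNonsplit_of_divisibilityRat_of_le`). [cite: GreenbergLNM1716, §4 pp. 112–113]
[cite: SkinnerUrban2014, proof of Thm. 3.6.4 (p. 43; shape)] [cite: Miller2011LMS, Def. 1.1] -/
theorem mainConjectureAtTwoNonsplit_of_missingLowerBoundAt
    (hEC : TwoAdicEulerCharRankZeroNonsplitMult W 0)
    (hGZK : rank_eq_analyticRank_of_analyticRank_le_one)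
    (hmult : Mult W 2) (hns : ¬ W.HasSplitMultiplicativeReductionAtPrime 2)
    (hL : W.entireLFunction 1 ≠ 0)
    {κ : ZpExtension ℚ 2} {γ : Field.absoluteGaloisGroup ℚ} {N : ℕ} [NeZero N]
    {f : CuspForm (Gamma0 N) 2} (hκ : κ.IsCyclotomic) (hγ : κ.IsTopGenerator γ)
    (hγ' : IsCyclotomicVariable 2 γ) (hf : IsNewformOf W f) {L : PowerSeries ℚ_[2]}
    (hLf : IsMultPAdicLFunctionOf f 2 (-1) L) (D : W.SelmerDualData κ γ) {ϖ : ℚ}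
    (hϖ : (ϖ : ℝ) * W.realPeriodRat = plusPeriod f)
    (hdiv : D.IsTorsion ∧ ∃ g ∈ D.charIdeal, iwasawaToPowerSeries 2 g =
        PowerSeries.C (ϖ : ℚ_[2]) * L)
    (hlow : MissingLowerBoundAt W 2) :
    D.IsTorsion ∧ ∃ g : IwasawaAlgebra 2, D.charIdeal = Ideal.span {g} ∧
      iwasawaToPowerSeries 2 g = PowerSeries.C (ϖ : ℚ_[2]) * L := by
  have hϖ0 : ϖ ≠ 0 := by
    rintro rfl
    have hper : 0 < plusPeriod f := IsNewform0.plusPeriod_pos_holds hf.1 hf.coeffField_eq_bot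
    rw [← hϖ, Rat.cast_zero, zero_mul] at hper
    exact lt_irrefl _ hper
  have hr : W.analyticRank = 0 := analyticRank_eq_zero_of_entireLFunction_one_ne_zero W hL
  obtain ⟨-, hfin⟩ := hGZK W (by rw [hr]; exact zero_le_one)
  exact mainConjectureAtTwoNonsplit_of_divisibilityRat_of_le W hEC hmult hns hL hfin hκ hγ hγ' hf hLf
    D ϖ hϖ hϖ0 hdiv (fun t ht => by
      have h := valuation_le_of_missingLowerBoundAt W hGZK hL hlow ht
      linarith)

/-- **The equivalence at a non-split `2`-adic Kato–Néron datum (PROVED).** At analytic rank `0`, given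
the display A235 at `2`, modularity-free data (`f`, `L`, `ϖ`, `D`), GZK and the integral datum
`ι L₀ = ϖ·L`, `L₀ ∈ char_Λ X`, `X` torsion: `MissingLowerBoundAt W 2 ↔ char_Λ X = (g)` for some `g` with
`ι g = ϖ·L`. (→) `mainConjectureAtTwoNonsplit_of_missingLowerBoundAt`; (←) the main conjecture gives
the Eisenstein datum for every generator (`multEisenstein_nonsplit_of_charIdeal_eq`) and the lower
chain of part 1 at `ϖ′ = ϖ`, `k = 0`. [cite: SkinnerUrban2014, proof of Thm. 3.6.4 (p. 43; shape)]
[cite: Miller2011LMS, Def. 1.1] -/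
theorem missingLowerBoundAt_iff_mainConjecture_nonsplit_two
    (hEC : TwoAdicEulerCharRankZeroNonsplitMult W 0)
    (hGZK : rank_eq_analyticRank_of_analyticRank_le_one)
    (hmult : Mult W 2) (hns : ¬ W.HasSplitMultiplicativeReductionAtPrime 2)
    (hL : W.entireLFunction 1 ≠ 0)
    {κ : ZpExtension ℚ 2} {γ : Field.absoluteGaloisGroup ℚ} {N : ℕ} [NeZero N]
    {f : CuspForm (Gamma0 N) 2} (hκ : κ.IsCyclotomic) (hγ : κ.IsTopGenerator γ)
    (hγ' : IsCyclotomicVariable 2 γ) (hf : IsNewformOf W f) {L : PowerSeries ℚ_[2]}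
    (hLf : IsMultPAdicLFunctionOf f 2 (-1) L) (D : W.SelmerDualData κ γ) {ϖ : ℚ}
    (hϖ : (ϖ : ℝ) * W.realPeriodRat = plusPeriod f)
    (hdiv : D.IsTorsion ∧ ∃ g ∈ D.charIdeal, iwasawaToPowerSeries 2 g =
        PowerSeries.C (ϖ : ℚ_[2]) * L) :
    MissingLowerBoundAt W 2 ↔ ∃ g : IwasawaAlgebra 2, D.charIdeal = Ideal.span {g} ∧
      iwasawaToPowerSeries 2 g = PowerSeries.C (ϖ : ℚ_[2]) * L := by
  refine ⟨fun hlow => (mainConjectureAtTwoNonsplit_of_missingLowerBoundAt W hEC hGZK hmult hns hL hκ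
    hγ hγ' hf hLf D hϖ hdiv hlow).2, fun hmc => ?_⟩
  have hϖ0 : ϖ ≠ 0 := by
    rintro rfl
    have hper : 0 < plusPeriod f := IsNewform0.plusPeriod_pos_holds hf.1 hf.coeffField_eq_bot
    rw [← hϖ, Rat.cast_zero, zero_mul] at hper
    exact lt_irrefl _ hper
  obtain ⟨q, hq, hle⟩ := lowerBound_two_nonsplit_of_eisensteinDivisibility W hEC hGZK hmult hns hL hκ
    hγ hγ' hf hLf D hdiv.1 ϖ hϖ hϖ0 0 (by simp) (multEisenstein_nonsplit_of_charIdeal_eq W D hmc)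
  exact ⟨q, hq, by simpa using hle⟩

/-! ## §3 Split `2`: the lower half + the split Kato–Néron datum ⇒ the main conjecture at the datum -/

omit [W.IsGloballyMinimal] in
/-- **Split multiplicative `2`, analytic rank `0`: `MissingLowerBoundAt W 2` + the split integral
Kato–Néron datum ⇒ `char_Λ X = (L₁)` up to the conceded `T` (PROVED).** Inputs: the split display at
`2` (`hEC`), a Tate datum with `log₂ q ≠ 0`, GZK, `L(E,1) ≠ 0`, a newform `f` with a split `2`-adic
`L`-function `L`, the forward `κ₁`-inequality for `L` (`hκ₁`; Greenberg–Stevens at `2`,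
`kappaOne_of_greenbergStevens`), the period ratio `ϖ`, the datum "`X` torsion and
`ι(T·L₁) = ϖ · L` for some `L₁ ∈ char_Λ X`" (`hdiv`; = K11b-Rat upgraded by `μ = 0` and `hint`,
`X5/TwoAdicTargetsSplitEndAlpha.lean`) and the lower half (`hlow`) ⇒ `char_Λ X = (g)`, `ι(T·g) = ϖ·L`
(`mainConjectureAtTwoSplit_of_divisibilityRat_of_le` with the reverse inequality assembled from `hlow`
and `hκ₁`). `W.IsGloballyMinimal` is needed by the inputs' meaning, not by the term.
[cite: GreenbergLNM1716, §4 pp. 112–113 and §3 p. 94] [cite: Miller2011LMS, Def. 1.1] -/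
theorem mainConjectureAtTwoSplit_of_missingLowerBoundAt [W.IsGloballyMinimal]
    (hEC : TwoAdicEulerCharRankZeroSplitMult W 0)
    (hGZK : rank_eq_analyticRank_of_analyticRank_le_one)
    (hmult : Mult W 2) (hsp : W.HasSplitMultiplicativeReductionAtPrime 2)
    (hL : W.entireLFunction 1 ≠ 0)
    {κ : ZpExtension ℚ 2} {γ : Field.absoluteGaloisGroup ℚ} {N : ℕ} [NeZero N]
    {f : CuspForm (Gamma0 N) 2} (hκ : κ.IsCyclotomic) (hγ : κ.IsTopGenerator γ)
    (hγ' : IsCyclotomicVariable 2 γ) (hf : IsNewformOf W f)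
    (Dq : TateParameterData W 2) (hlog : padicLog 2 Dq.q ≠ 0) {L : PowerSeries ℚ_[2]}
    (hκ₁ : PowerSeries.coeff 1 L ≠ 0 ∧ (PowerSeries.coeff 1 L).valuation ≤
      padicValRat 2 (ratPlusSymbol f 0) + ((LInvariant Dq).valuation - 2))
    (D : W.SelmerDualData κ γ) {ϖ : ℚ} (hϖ : (ϖ : ℝ) * W.realPeriodRat = plusPeriod f)
    (hdiv : D.IsTorsion ∧ ∃ g ∈ D.charIdeal, iwasawaToPowerSeries 2 (PowerSeries.X * g) =
        PowerSeries.C (ϖ : ℚ_[2]) * L)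
    (hlow : MissingLowerBoundAt W 2) :
    D.IsTorsion ∧ ∃ g : IwasawaAlgebra 2, D.charIdeal = Ideal.span {g} ∧
      iwasawaToPowerSeries 2 (PowerSeries.X * g) = PowerSeries.C (ϖ : ℚ_[2]) * L := by
  -- `t = ϖ · s = L(E,1)/Ω_E`, `s = [0]⁺_f`
  have hΩpos : 0 < W.realPeriodRat := W.realPeriodRat_pos_holds
  have hϖ0 : ϖ ≠ 0 := by
    rintro rfl
    have hper : 0 < plusPeriod f := IsNewform0.plusPeriod_pos_holds hf.1 hf.coeffField_eq_bot
    rw [← hϖ, Rat.cast_zero, zero_mul] at hper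
    exact lt_irrefl _ hper
  set s : ℚ := ratPlusSymbol f 0 with hs_def
  set t : ℚ := ϖ * s with ht_def
  have hLval : W.entireLFunction 1 = (((s : ℝ) * plusPeriod f : ℝ) : ℂ) := hf.entireLFunction_one_eq
  have ht : W.entireLFunction 1 / (W.realPeriodRat : ℂ) = ((t : ℚ) : ℂ) := by
    rw [hLval, ← hϖ, div_eq_iff (Complex.ofReal_ne_zero.mpr hΩpos.ne'), ht_def]
    push_cast
    ring
  have hs0 : s ≠ 0 := by
    intro h0
    apply hL
    rw [hLval, h0]
    simp
  have hvt : padicValRat 2 t = padicValRat 2 ϖ + padicValRat 2 s := by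
    rw [ht_def, padicValRat.mul hϖ0 hs0]
  have hr : W.analyticRank = 0 := analyticRank_eq_zero_of_entireLFunction_one_ne_zero W hL
  obtain ⟨-, hfin⟩ := hGZK W (by rw [hr]; exact zero_le_one)
  have hvle := valuation_le_of_missingLowerBoundAt W hGZK hL hlow ht
  refine mainConjectureAtTwoSplit_of_divisibilityRat_of_le W hEC hmult hsp hfin hκ hγ hγ' Dq hlog hκ₁.1
    D hϖ0 hdiv ?_
  have h2 := hκ₁.2
  linarith

omit [W.IsGloballyMinimal] in
/-- **The equivalence at a split `2`-adic Kato–Néron datum (PROVED).** At analytic rank `0`, given the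
display A236 at `2`, a Tate datum, BOTH `κ₁`-inequalities for `L` (Greenberg–Stevens at `2` gives the
equality: `kappaOne_of_greenbergStevens`, `kappaOne_ge_of_greenbergStevens`), `L(0) = 0`, GZK and the
split integral datum `ι(T·L₁) = ϖ·L`, `L₁ ∈ char_Λ X`, `X` torsion:
`MissingLowerBoundAt W 2 ↔ ∃ g, char_Λ X = (g) ∧ ι(T·g) = ϖ·L`. (→) §3; (←)
`multEisenstein_split_of_charIdeal_eq` and the split lower chain of part 2 at `ϖ′ = ϖ`, `k = 0`.
[cite: SkinnerUrban2014, proof of Thm. 3.6.4 (p. 43; shape)] [cite: Miller2011LMS, Def. 1.1] -/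
theorem missingLowerBoundAt_iff_mainConjecture_split_two [W.IsGloballyMinimal]
    (hEC : TwoAdicEulerCharRankZeroSplitMult W 0)
    (hGZK : rank_eq_analyticRank_of_analyticRank_le_one)
    (hmult : Mult W 2) (hsp : W.HasSplitMultiplicativeReductionAtPrime 2)
    (hL : W.entireLFunction 1 ≠ 0)
    {κ : ZpExtension ℚ 2} {γ : Field.absoluteGaloisGroup ℚ} {N : ℕ} [NeZero N]
    {f : CuspForm (Gamma0 N) 2} (hκ : κ.IsCyclotomic) (hγ : κ.IsTopGenerator γ)
    (hγ' : IsCyclotomicVariable 2 γ) (hf : IsNewformOf W f)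
    (Dq : TateParameterData W 2) (hlog : padicLog 2 Dq.q ≠ 0) {L : PowerSeries ℚ_[2]}
    (hL0 : PowerSeries.constantCoeff L = 0)
    (hκ₁ : PowerSeries.coeff 1 L ≠ 0 ∧ (PowerSeries.coeff 1 L).valuation ≤
      padicValRat 2 (ratPlusSymbol f 0) + ((LInvariant Dq).valuation - 2))
    (hκ₁' : padicValRat 2 (ratPlusSymbol f 0) + ((LInvariant Dq).valuation - 2) ≤
      (PowerSeries.coeff 1 L).valuation)
    (D : W.SelmerDualData κ γ) {ϖ : ℚ} (hϖ : (ϖ : ℝ) * W.realPeriodRat = plusPeriod f)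
    (hdiv : D.IsTorsion ∧ ∃ g ∈ D.charIdeal, iwasawaToPowerSeries 2 (PowerSeries.X * g) =
        PowerSeries.C (ϖ : ℚ_[2]) * L) :
    MissingLowerBoundAt W 2 ↔ ∃ g : IwasawaAlgebra 2, D.charIdeal = Ideal.span {g} ∧
      iwasawaToPowerSeries 2 (PowerSeries.X * g) = PowerSeries.C (ϖ : ℚ_[2]) * L := by
  refine ⟨fun hlow => (mainConjectureAtTwoSplit_of_missingLowerBoundAt W hEC hGZK hmult hsp hL hκ hγ
    hγ' hf Dq hlog hκ₁ D hϖ hdiv hlow).2, fun hmc => ?_⟩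
  have hϖ0 : ϖ ≠ 0 := by
    rintro rfl
    have hper : 0 < plusPeriod f := IsNewform0.plusPeriod_pos_holds hf.1 hf.coeffField_eq_bot
    rw [← hϖ, Rat.cast_zero, zero_mul] at hper
    exact lt_irrefl _ hper
  obtain ⟨q, hq, hle⟩ := lowerBound_two_split_of_eisensteinDivisibility W hEC hGZK hmult hsp hL hκ hγ
    hγ' hf Dq hlog hL0 hκ₁' D hdiv.1 ϖ hϖ hϖ0 0 (by simp) (multEisenstein_split_of_charIdeal_eq W D hmc)
  exact ⟨q, hq, by simpa using hle⟩

/-! ## §4 The ANALYTIC `μ = 0` upgrade: T-mult-4 (`⊗ℚ`) + {`ϖ·L₂ ∈ ι(Λ)`, `μ(ϖ·L₂) = 0`} ⇒ T-mult-4-int -/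

/-- **Master cancellation on the Eisenstein side (pure `Λ`-algebra, any prime `p`).** In
`Λ = ℤ_p⟦T⟧`: if `μ(L₀) = 0` and `C(num) · (C(p^n) · F) = (C(den) · h) · L₀` with `num ≠ 0` an
integer and `den ≠ 0` a natural number, then `F ∈ (L₀)`. Proof: the master cancellation
`mem_span_of_mul_eq_C_pow_mul_of_mu_le` (`μ(L₀) = 0 ≤ μ(C(num)·F)`) gives `C(num)·F ∈ (L₀)`; write
`num = ±|num|` and strip `|num|` (`mem_span_of_C_natCast_mul_mem_span`). The Eisenstein twin of the
Greenberg–Vatsal upgrade `MuZeroUpgrade.mem_span_singleton_of_mul_eq_C_pow_mul`.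
[cite: GreenbergVatsal2000, p. 4 (after Thm. (1.2); shape: μ = 0 cancels powers of p)] -/
theorem mem_span_of_C_int_mul_C_pow_mul_eq {p : ℕ} [Fact p.Prime] {L₀ F h : IwasawaAlgebra p}
    (hμ : mu L₀ = 0) {n : ℕ} {num : ℤ} (hnum : num ≠ 0) {den : ℕ}
    (hkey : PowerSeries.C (num : ℤ_[p]) * (PowerSeries.C ((p : ℤ_[p]) ^ n) * F) =
      (PowerSeries.C (den : ℤ_[p]) * h) * L₀) : F ∈ Ideal.span {L₀} := by
  by_cases hF : F = 0
  · simp [hF]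
  have hCnum : (PowerSeries.C (num : ℤ_[p]) : IwasawaAlgebra p) ≠ 0 := by
    rw [Ne, ← map_zero (PowerSeries.C (R := ℤ_[p])), PowerSeries.C_injective.eq_iff]
    exact_mod_cast hnum
  have hL₀ : L₀ ≠ 0 := by
    rintro rfl
    rw [mul_zero] at hkey
    exact mul_ne_zero hCnum (mul_ne_zero (C_pow_ne_zero n) hF) hkey
  -- `C(num)·F ∈ (L₀)` by the master cancellation (`μ(L₀) = 0`)
  have h1 : PowerSeries.C (num : ℤ_[p]) * F ∈ Ideal.span {L₀} := by
    refine MuZeroUpgrade.mem_span_of_mul_eq_C_pow_mul_of_mu_le hL₀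
      (b := PowerSeries.C (den : ℤ_[p]) * h) (e := n) ?_ (hμ ▸ Nat.zero_le _)
    rw [← hkey]; ring
  -- strip the integer `num = sign · |num|`
  have hC : PowerSeries.C (num : ℤ_[p]) =
      PowerSeries.C ((num.sign : ℤ) : ℤ_[p]) * PowerSeries.C ((num.natAbs : ℕ) : ℤ_[p]) := by
    rw [← map_mul]
    congr 1
    have h0 : (((num.sign * (num.natAbs : ℤ) : ℤ)) : ℤ_[p]) = (num : ℤ_[p]) := by
      rw [Int.sign_mul_natAbs]
    rw [Int.cast_mul, Int.cast_natCast] at h0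
    exact h0.symm
  have hunit : IsUnit (PowerSeries.C ((num.sign : ℤ) : ℤ_[p]) : IwasawaAlgebra p) := by
    rcases lt_or_gt_of_ne hnum with hneg | hpos
    · rw [Int.sign_eq_neg_one_of_neg hneg]; push_cast; rw [map_neg, map_one]; exact isUnit_one.neg
    · rw [Int.sign_eq_one_of_pos hpos]; push_cast; rw [map_one]; exact isUnit_one
  have h2 : PowerSeries.C ((num.natAbs : ℕ) : ℤ_[p]) * (PowerSeries.C ((num.sign : ℤ) : ℤ_[p]) * F) ∈
      Ideal.span {L₀} := by
    have h3 : PowerSeries.C ((num.natAbs : ℕ) : ℤ_[p]) * (PowerSeries.C ((num.sign : ℤ) : ℤ_[p]) * F) =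
        PowerSeries.C (num : ℤ_[p]) * F := by rw [hC]; ring
    rw [h3]; exact h1
  have h4 := MuZeroUpgrade.mem_span_of_C_natCast_mul_mem_span hL₀ (Int.natAbs_ne_zero.mpr hnum)
    (M := PowerSeries.C ((num.sign : ℤ) : ℤ_[p]) * F) (hμ ▸ Nat.zero_le _) h2
  exact (Ideal.unit_mul_mem_iff_mem _ hunit).mp h4

/-- **The analytic `μ = 0` upgrade at `p = 2` (any `F ∈ Λ`, any `L ∈ ℚ₂⟦T⟧`).** A `⊗ℚ` Eisenstein
datum `2ⁿ · ι F = ι h · L` (T-mult-4 shape, `F = f_X` or `T·f_X`), an integral normalisation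
`ι L₀ = ϖ · L` (`ϖ ∈ ℚ^×`; the Néron-integrality certificate `hint` of the `μ = 0` road) and
`μ(L₀) = 0` (the ANALYTIC `μ`-certificate `AnalyticMuLE W 2 0`, read by
`MuZeroUpgrade.mu_eq_zero_of_lt_norm_coeff`) give the INTEGRAL datum `ι F = ι h′ · (ϖ · L)`.
[cite: GreenbergVatsal2000, p. 4 (shape)] -/
theorem exists_eq_mul_of_ratDatum_of_mu_eq_zero {F h L₀ : IwasawaAlgebra 2} {L : PowerSeries ℚ_[2]}
    {n : ℕ} (hrat : PowerSeries.C ((2 : ℚ_[2]) ^ n) * iwasawaToPowerSeries 2 F =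
      iwasawaToPowerSeries 2 h * L)
    {ϖ : ℚ} (hϖ0 : ϖ ≠ 0) (hL₀ : iwasawaToPowerSeries 2 L₀ = PowerSeries.C (ϖ : ℚ_[2]) * L)
    (hμ : mu L₀ = 0) :
    ∃ h' : IwasawaAlgebra 2, iwasawaToPowerSeries 2 F =
      iwasawaToPowerSeries 2 h' * (PowerSeries.C (ϖ : ℚ_[2]) * L) := by
  have hιC : ∀ x : ℤ_[2], iwasawaToPowerSeries 2 (PowerSeries.C x) = PowerSeries.C (x : ℚ_[2]) :=
    fun x => by rw [iwasawaToPowerSeries, PowerSeries.map_C]; rfl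
  have hϖd : (ϖ.num : ℚ_[2]) = (ϖ : ℚ_[2]) * (ϖ.den : ℚ_[2]) := by
    have h1 : ((ϖ * ϖ.den : ℚ) : ℚ_[2]) = ((ϖ.num : ℚ) : ℚ_[2]) := by rw [Rat.mul_den_eq_num]
    push_cast at h1
    exact h1.symm
  have h2 : ((((2 : ℕ) : ℤ_[2]) ^ n : ℤ_[2]) : ℚ_[2]) = (2 : ℚ_[2]) ^ n := by push_cast; rfl
  -- the `Λ`-identity `C(num)·(C(2^n)·F) = (C(den)·h)·L₀`
  have hkey : PowerSeries.C (ϖ.num : ℤ_[2]) * (PowerSeries.C (((2 : ℕ) : ℤ_[2]) ^ n) * F) =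
      (PowerSeries.C (ϖ.den : ℤ_[2]) * h) * L₀ := by
    apply iwasawaToPowerSeries_injective 2
    rw [map_mul, map_mul, map_mul, map_mul, hιC, hιC, hιC, hL₀, h2, hrat]
    have e1 : (((ϖ.num : ℤ_[2]) : ℚ_[2])) = (ϖ.num : ℚ_[2]) := by norm_cast
    have e2 : (((ϖ.den : ℤ_[2]) : ℚ_[2])) = (ϖ.den : ℚ_[2]) := by norm_cast
    rw [e1, e2, hϖd, map_mul]
    ring
  have hmem : F ∈ Ideal.span {L₀} :=
    mem_span_of_C_int_mul_C_pow_mul_eq (p := 2) hμ (Rat.num_ne_zero.mpr hϖ0) hkey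
  obtain ⟨h', hh'⟩ := Ideal.mem_span_singleton'.mp hmem
  exact ⟨h', by rw [← hh', map_mul, hL₀]⟩

/-- **T-mult-4 (`⊗ℚ`) + the two analytic certificates ⇒ T-mult-4-int (PROVED).** The cell's
valuation-blind Eisenstein target `MultLowerDivisibilityAtTwoRat W` (T-mult-4 — the research object of
the rank-`0` `2`-CONVERSE road, `X5/TwoAdicTargetsMultConverse.lean`), the Néron-integrality
certificate `hint` (`ϖ·L₂(f) ∈ ι(Λ)` for every newform `f`, the same binder as the `μ = 0` road's) and
the ANALYTIC `μ`-certificate `X2.AnalyticMuLE W 2 0` (`μ(ϖ·L₂) = 0`: ONE coefficient of norm `> 1/2`;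
kit-certified per curve, EVIDENCE) imply the integral target `MultEisensteinDivisibilityAtTwo W`. So on
every class carrying the two certificates, the lower half (item 19923) and the rank-`0` `2`-converse
(item 19219's road `…_of_multLowerRat`) hinge on the SAME `⊗ℚ` research object T-mult-4.
[cite: GreenbergVatsal2000, p. 4 (shape)] [cite: Skinner2016PacificMC, Thm. A/B (§1; shape only)] -/
theorem multEisensteinDivisibilityAtTwo_of_multLowerRat_of_analyticMu
    (hrat : MultLowerDivisibilityAtTwoRat W)
    (hint : ∀ {N : ℕ} [NeZero N] (f : CuspForm (Gamma0 N) 2), IsNewformOf W f →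
      ∀ ϖ : ℚ, (ϖ : ℝ) * W.realPeriodRat = plusPeriod f → ∀ L : PowerSeries ℚ_[2],
      (W.HasSplitMultiplicativeReductionAtPrime 2 → IsSplitMultPAdicLFunctionOf f 2 L) →
      (¬ W.HasSplitMultiplicativeReductionAtPrime 2 → IsMultPAdicLFunctionOf f 2 (-1) L) →
        ∃ L₀ : IwasawaAlgebra 2, iwasawaToPowerSeries 2 L₀ = PowerSeries.C (ϖ : ℚ_[2]) * L)
    (hμan : X2.AnalyticMuLE W 2 0) : MultEisensteinDivisibilityAtTwo W := by
  intro κ γ hκ hγ hγ' hmult N _ f hf ϖ hϖ D fE hchar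
  have hϖ0 : ϖ ≠ 0 := by
    rintro rfl
    have hper : 0 < plusPeriod f := IsNewform0.plusPeriod_pos_holds hf.1 hf.coeffField_eq_bot
    rw [← hϖ, Rat.cast_zero, zero_mul] at hper
    exact lt_irrefl _ hper
  obtain ⟨hns_rat, hsp_rat⟩ := hrat κ γ hκ hγ hγ' hmult f hf D fE hchar
  refine ⟨fun hns L hLf => ?_, fun hsp L hLf => ?_⟩
  · obtain ⟨L₀, hL₀⟩ := hint f hf ϖ hϖ L (fun hsp => absurd hsp hns) (fun _ => hLf)
    obtain ⟨k, hk⟩ := hμan f hf ϖ hϖ L (fun hsp => absurd hsp hns) (fun _ => hLf)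
    have hμ : mu L₀ = 0 := by
      refine MuZeroUpgrade.mu_eq_zero_of_lt_norm_coeff (p := 2) (L₀ := L₀) (n := k) ?_
      rw [hL₀]; exact_mod_cast hk
    obtain ⟨n, h, hnh⟩ := hns_rat hns L hLf
    exact exists_eq_mul_of_ratDatum_of_mu_eq_zero hnh hϖ0 hL₀ hμ
  · obtain ⟨L₀, hL₀⟩ := hint f hf ϖ hϖ L (fun _ => hLf) (fun hns => absurd hsp hns)
    obtain ⟨k, hk⟩ := hμan f hf ϖ hϖ L (fun _ => hLf) (fun hns => absurd hsp hns)
    have hμ : mu L₀ = 0 := by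
      refine MuZeroUpgrade.mu_eq_zero_of_lt_norm_coeff (p := 2) (L₀ := L₀) (n := k) ?_
      rw [hL₀]; exact_mod_cast hk
    obtain ⟨n, h, hnh⟩ := hsp_rat hsp L hLf
    exact exists_eq_mul_of_ratDatum_of_mu_eq_zero hnh hϖ0 hL₀ hμ

end Summit.BirchSwinnertonDyer.Rank1Residual.X5.O1

end
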